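import Literature.MathematicalPhysics.QuantumManyBody.BogoliubovQuarticBounds
import Literature.MathematicalPhysics.QuantumManyBody.BogoliubovCubicBlock
import HarnessLib

/-!
# The momentum-conserving quartic form of a Bogoliubov–Weyl trial state: main terms and errors

Topic `Literature/MathematicalPhysics/QuantumManyBody`, namespace `BoseGas.Fock`; theorem-only sequel
of `BogoliubovQuarticBounds.lean` and `BogoliubovCubicBlock.lean` for the provefact
`Literature.MathematicalPhysics.QuantumManyBody.BoseGas.BastiCenatiempoSchlein2021_upperBound`
(Prop. 3.1 of [BastiCenatiempoSchlein2021], the part concerning `𝒱_N`).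

`norm_quarticForm_sub_main_le`: for a vector `ξ` which is graded by a constant weight `g`
(`g, 2g, 4g ≠ 0`), balanced between the hard and soft mode sets `P_H`, `P_S` (weights `1`, `-2`),
annihilated off `P_H ∪ P_S ∌ z`, and Bogoliubov–Weyl data `(σ, P, t, N₀)` even under an involution
`σ` reversing the (injective) momentum labels, the momentum-conserving quartic form
`∑ c ⟨A_qA_pξ, A_{q'}A_{p'}ξ⟩` (`A = conjAn`, `c(p,q,p',q') = [e p+e q = e p'+e q'] W(e p'-e p)`,
`W` even, `|W| ≤ W₀`) equals
`N₀²W(0)‖ξ‖² + N₀·C₂‖ξ‖² + C_{G₂}‖ξ‖² + C_{G₃}‖ξ‖² + ∑_{P_H⁴} cγγγγ⟨a_qa_pξ, a_{q'}a_{p'}ξ⟩ + √N₀·ℒ⁽³⁾`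
(the constants `ℒ^{(0)}`, `𝒢^{(2,V)}`, the `G₂`/`G₃` constants of [ibid., Prop. 3.1 (`C_{𝒢_N}`)],
the hard pair-annihilation block `𝒱_N^{(H)}`-type and the cubic block in triple form) up to an error
bounded by `N₀·4W₀(g₀²+s₀²+gs₀)M₁ + (4gs₀Λ + 4W₀S₂g₀²)M₁ + 4W₀g₀²S₂M₂ + 4W₀S₂s₀²M₁ + W₀s₀²S₂^QM₂ + 2W₀g₀⁴|P_S|M₂`
(`M₁ = ∑‖a_pξ‖²`, `M₂ = ∑‖a_ya_xξ‖²`, `S₂ = ∑σ²`, sup bounds `g₀, s₀, gs₀` on `P_H ∪ P_S`,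
`Λ ≥ ∑_p|W(k-e p)||γ_pσ_p|`) — the errors of §4 of [ibid.] in the norm parameters of `ξ`.

## References

* [BastiCenatiempoSchlein2021] G. Basti, S. Cenatiempo, B. Schlein, Forum Math. Sigma 9 (2021) e74,
  arXiv:2101.06222: (3.1)–(3.2), Prop. 3.1, §4.
-/

noncomputable section

namespace Literature.MathematicalPhysics.QuantumManyBody.BoseGas

open Complex MvPolynomial Finset
open scoped ComplexConjugate BigOperators

namespace Fock

section Assembly

variable {ι : Type*} [Fintype ι] [DecidableEq ι] {z : ι} {σ : ι → ι} {P : Finset ι} {N₀ : ℝ}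
  {t : ι → ℝ} {e : ι → Momentum}

omit [Fintype ι] [DecidableEq ι] in
/-- `‖a + b + c + d‖ ≤ ‖a‖ + ‖b‖ + ‖c‖ + ‖d‖`. [folklore] -/
theorem norm_add₄_le (a b c d : ℂ) : ‖a + b + c + d‖ ≤ ‖a‖ + ‖b‖ + ‖c‖ + ‖d‖ := by
  have h1 := norm_add_le (a + b + c) d
  have h2 : ‖a + b + c‖ ≤ ‖a‖ + ‖b‖ + ‖c‖ := norm_add₃_le
  linarith

/-- **The quartic form of the trial functional: main terms and errors** (the `𝒱_N`-part of
Prop. 3.1 of [ibid.] with the cubic and hard-quartic blocks kept symbolic). See the module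
docstring. [cite: BastiCenatiempoSchlein2021, (3.1)–(3.2), Prop. 3.1, §4] -/
theorem norm_quarticForm_sub_main_le
    {M : Type*} [AddCommGroup M] {g : M} (h1 : g ≠ 0) (h2 : 2 • g ≠ 0) (h4 : 4 • g ≠ 0)
    (hσ : Function.Involutive σ) (hP : ∀ p ∈ P, σ p ∉ P) (hσz : σ z = z)
    (he : Function.Injective e) (hez : e z = 0) (heσ : ∀ p, e (σ p) = -e p) (hN₀ : 0 ≤ N₀)
    (W : Momentum → ℂ) {W₀ : ℝ} (hW : ∀ k, ‖W k‖ ≤ W₀) (hWev : ∀ k, W (-k) = W k)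
    {PH PS : Finset ι} (hHS : Disjoint PH PS) (hzH : z ∉ PH) (hzS : z ∉ PS)
    (hQσ : ∀ p ∈ PH ∪ PS, σ p ∈ PH ∪ PS)
    {g₀ s₀ gs₀ Λ : ℝ} (hg₀ : 0 ≤ g₀) (hs₀ : 0 ≤ s₀) (hgs₀ : 0 ≤ gs₀)
    (hgQ : ∀ p ∈ PH ∪ PS, |bogGamma σ P t p| ≤ g₀) (hsQ : ∀ p ∈ PH ∪ PS, |bogSigma σ P t p| ≤ s₀)
    (hgsQ : ∀ p ∈ PH ∪ PS, |bogGamma σ P t p * bogSigma σ P t p| ≤ gs₀)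
    (hΛle : ∀ k, ∑ p, ‖W (k - e p)‖ * |bogGamma σ P t p * bogSigma σ P t p| ≤ Λ)
    {ξ : MvPolynomial ι ℂ} {m : M} (hξ : IsWeightedHomogeneous (fun _ : ι => g) ξ m)
    {m' : ℤ} (hwt : IsWeightedHomogeneous (fun i : ι => if i ∈ PH then (1 : ℤ) else if i ∈ PS then -2 else 0) ξ m')
    (hξQ : ∀ p ∉ PH ∪ PS, pderiv p ξ = 0) :
    ‖(∑ p, ∑ q, ∑ p', ∑ q', pairCoeff' e W p q p' q' *
        fockInner (conjAn z σ P N₀ t q (conjAn z σ P N₀ t p ξ))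
          (conjAn z σ P N₀ t q' (conjAn z σ P N₀ t p' ξ))) -
      ( -- the hard pair-annihilation block
        (∑ p ∈ PH, ∑ q ∈ PH, ∑ p' ∈ PH, ∑ q' ∈ PH, pairCoeff' e W p q p' q' *
          ((bogGamma σ P t q * bogGamma σ P t p * (bogGamma σ P t q' * bogGamma σ P t p') : ℝ) : ℂ) *
            fockInner (pderiv q (pderiv p ξ)) (pderiv q' (pderiv p' ξ))) +
        -- the cubic block in triple form
        (Real.sqrt N₀ : ℂ) * (∑ i, ∑ j, ∑ k, (if e i + e j + e k = 0 then
          ((W (-e k) + W (e j)) * ((bogGamma σ P t i * bogSigma σ P t j * bogSigma σ P t k : ℝ) : ℂ) +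
              (W (-e i) + W (e j)) * ((bogGamma σ P t i * bogGamma σ P t j * bogSigma σ P t k : ℝ) : ℂ)) *
            fockInner ξ (X i * (X j * (X k * ξ))) +
          ((W (e k) + W (-e j)) * ((bogGamma σ P t i * bogSigma σ P t j * bogSigma σ P t k : ℝ) : ℂ) +
              (W (e i) + W (-e j)) * ((bogGamma σ P t i * bogGamma σ P t j * bogSigma σ P t k : ℝ) : ℂ)) *
            fockInner (X i * (X j * (X k * ξ))) ξ else 0)) +
        -- the constants: `ℒ⁽⁰⁾`, `𝒢^{(2,V)}`, `G₂`, `G₃`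
        ((N₀ : ℂ) ^ 2 * W 0 +
          (N₀ : ℂ) * (∑ p, ((2 * W 0 + W (e p) + W (-e p)) * ((bogSigma σ P t p ^ 2 : ℝ) : ℂ) +
            (W (e p) + W (-e p)) * ((bogGamma σ P t p * bogSigma σ P t p : ℝ) : ℂ))) +
          (∑ p, ∑ p', W (e p' - e p) *
            (((bogGamma σ P t p * bogSigma σ P t p * (bogGamma σ P t p' * bogSigma σ P t p')) : ℝ) : ℂ)) +
          ((∑ p, ∑ q, W (e q - e p) * (((bogSigma σ P t p ^ 2 * bogSigma σ P t q ^ 2 : ℝ)) : ℂ)) +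
            W 0 * ((((∑ p, bogSigma σ P t p ^ 2) ^ 2 : ℝ)) : ℂ))) * fockInner ξ ξ )‖ ≤
      N₀ * (4 * W₀ * (g₀ ^ 2 + s₀ ^ 2 + gs₀) * ∑ p, (fockInner (pderiv p ξ) (pderiv p ξ)).re) +
      (4 * gs₀ * Λ * ∑ p, (fockInner (pderiv p ξ) (pderiv p ξ)).re +
        4 * W₀ * (∑ p, bogSigma σ P t p ^ 2) * g₀ ^ 2 * ∑ p, (fockInner (pderiv p ξ) (pderiv p ξ)).re +
        4 * W₀ * g₀ ^ 2 * (∑ p, bogSigma σ P t p ^ 2) *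
          ∑ x, ∑ y, (fockInner (pderiv y (pderiv x ξ)) (pderiv y (pderiv x ξ))).re) +
      (4 * W₀ * (∑ p, bogSigma σ P t p ^ 2) * s₀ ^ 2 * ∑ p, (fockInner (pderiv p ξ) (pderiv p ξ)).re +
        W₀ * s₀ ^ 2 * (∑ p ∈ PH ∪ PS, bogSigma σ P t p ^ 2) *
          ∑ x, ∑ y, (fockInner (pderiv y (pderiv x ξ)) (pderiv y (pderiv x ξ))).re) +
      2 * W₀ * g₀ ^ 4 * PS.card * ∑ x, ∑ y, (fockInner (pderiv y (pderiv x ξ)) (pderiv y (pderiv x ξ))).re := by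
  have hzQ : z ∉ PH ∪ PS := by simp [Finset.mem_union, hzH, hzS]
  have hξz : pderiv z ξ = 0 := hξQ z hzQ
  rw [sum_pairCoeff_fockInner_conjPair_conjPair hP hσz hN₀ he hez heσ W hξz,
    L3_block_eq h1 hσ hP heσ W hξ]
  -- the quartic block `ℒ⁽⁴⁾ = G₁ + G₂ + G₃`
  set G1 : ℂ := ∑ p, ∑ q, ∑ p', ∑ q', pairCoeff' e W p q p' q' *
    ((bogGamma σ P t q * bogGamma σ P t p * (bogGamma σ P t q' * bogGamma σ P t p') : ℝ) : ℂ) *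
      fockInner (pderiv q (pderiv p ξ)) (pderiv q' (pderiv p' ξ)) with hG1
  set G2 : ℂ := ∑ p, ∑ q, ∑ p', ∑ q', pairCoeff' e W p q p' q' *
    fockInner (C ((bogGamma σ P t q * bogSigma σ P t p : ℝ) : ℂ) * pderiv q (X (σ p) * ξ) +
        C ((bogSigma σ P t q * bogGamma σ P t p : ℝ) : ℂ) * (X (σ q) * pderiv p ξ))
      (C ((bogGamma σ P t q' * bogSigma σ P t p' : ℝ) : ℂ) * pderiv q' (X (σ p') * ξ) +
        C ((bogSigma σ P t q' * bogGamma σ P t p' : ℝ) : ℂ) * (X (σ q') * pderiv p' ξ)) with hG2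
  set G3 : ℂ := ∑ p, ∑ q, ∑ p', ∑ q', pairCoeff' e W p q p' q' *
    ((((bogSigma σ P t q * bogSigma σ P t p * (bogSigma σ P t q' * bogSigma σ P t p')) : ℝ)) : ℂ) *
      fockInner (X (σ q) * (X (σ p) * ξ)) (X (σ q') * (X (σ p') * ξ)) with hG3
  have hL4 : ∑ p, ∑ q, ∑ p', ∑ q', pairCoeff' e W p q p' q' *
      fockInner (bogAn σ P t q (bogAn σ P t p ξ)) (bogAn σ P t q' (bogAn σ P t p' ξ)) = G1 + G2 + G3 := by
    simp only [hG1, hG2, hG3, ← Finset.sum_add_distrib]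
    refine Finset.sum_congr rfl fun p _ => Finset.sum_congr rfl fun q _ => Finset.sum_congr rfl fun p' _ =>
      Finset.sum_congr rfl fun q' _ => ?_
    rw [fockInner_bogAn_bogAn_of_graded h2 h4 hξ]
    ring
  rw [hL4]
  -- the four block estimates
  have hB1 := norm_G1_sub_H_le (σ := σ) (P := P) (t := t) he hHS W hW hg₀ hgQ ξ hξQ hwt
  have hB2 := norm_G2_sub_const_le hσ hP he heσ W hW hWev (PH ∪ PS) hg₀ hgs₀ hgQ hgsQ hΛle ξ hξQ
  have hB3 := norm_G3_sub_const_le hσ hP he heσ W hW (PH ∪ PS) hs₀ hsQ ξ hξQ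
  have hBL2 := norm_L2_block_sub_const_le (e := e) h2 hσ hP W hW (PH ∪ PS) hQσ hgQ hsQ hgsQ hξ hξQ
  rw [← hG1] at hB1
  rw [← hG2] at hB2
  rw [← hG3] at hB3
  -- regroup the difference into the four block differences
  set L2b : ℂ := (∑ p, (2 * W 0 + W (e p) + W (-e p)) * fockInner (bogAn σ P t p ξ) (bogAn σ P t p ξ)) +
      ∑ p, (W (-e p) * fockInner (bogAn σ P t (σ p) (bogAn σ P t p ξ)) ξ +
        W (e p) * fockInner ξ (bogAn σ P t (σ p) (bogAn σ P t p ξ))) with hL2b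
  set CL2 : ℂ := ∑ p, ((2 * W 0 + W (e p) + W (-e p)) * ((bogSigma σ P t p ^ 2 : ℝ) : ℂ) +
      (W (e p) + W (-e p)) * ((bogGamma σ P t p * bogSigma σ P t p : ℝ) : ℂ)) with hCL2
  set G1H : ℂ := ∑ p ∈ PH, ∑ q ∈ PH, ∑ p' ∈ PH, ∑ q' ∈ PH, pairCoeff' e W p q p' q' *
      ((bogGamma σ P t q * bogGamma σ P t p * (bogGamma σ P t q' * bogGamma σ P t p') : ℝ) : ℂ) *
        fockInner (pderiv q (pderiv p ξ)) (pderiv q' (pderiv p' ξ)) with hG1H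
  set C2 : ℂ := ∑ p, ∑ p', W (e p' - e p) *
      (((bogGamma σ P t p * bogSigma σ P t p * (bogGamma σ P t p' * bogSigma σ P t p')) : ℝ) : ℂ) with hC2
  set C3 : ℂ := (∑ p, ∑ q, W (e q - e p) * (((bogSigma σ P t p ^ 2 * bogSigma σ P t q ^ 2 : ℝ)) : ℂ)) +
      W 0 * ((((∑ p, bogSigma σ P t p ^ 2) ^ 2 : ℝ)) : ℂ) with hC3
  set L3T : ℂ := ∑ i, ∑ j, ∑ k, (if e i + e j + e k = 0 then
      ((W (-e k) + W (e j)) * ((bogGamma σ P t i * bogSigma σ P t j * bogSigma σ P t k : ℝ) : ℂ) +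
          (W (-e i) + W (e j)) * ((bogGamma σ P t i * bogGamma σ P t j * bogSigma σ P t k : ℝ) : ℂ)) *
        fockInner ξ (X i * (X j * (X k * ξ))) +
      ((W (e k) + W (-e j)) * ((bogGamma σ P t i * bogSigma σ P t j * bogSigma σ P t k : ℝ) : ℂ) +
          (W (e i) + W (-e j)) * ((bogGamma σ P t i * bogGamma σ P t j * bogSigma σ P t k : ℝ) : ℂ)) *
        fockInner (X i * (X j * (X k * ξ))) ξ else 0) with hL3T
  have hregroup : G1 + G2 + G3 + (Real.sqrt N₀ : ℂ) * L3T + (N₀ : ℂ) * L2b + (N₀ : ℂ) ^ 2 * (W 0 * fockInner ξ ξ) -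
      (G1H + (Real.sqrt N₀ : ℂ) * L3T + ((N₀ : ℂ) ^ 2 * W 0 + (N₀ : ℂ) * CL2 + C2 + C3) * fockInner ξ ξ) =
      (G1 - G1H) + (G2 - C2 * fockInner ξ ξ) + (G3 - C3 * fockInner ξ ξ) + (N₀ : ℂ) * (L2b - CL2 * fockInner ξ ξ) := by
    ring
  rw [hregroup]
  refine (norm_add₄_le _ _ _ _).trans ?_
  have hN : ‖(N₀ : ℂ) * (L2b - CL2 * fockInner ξ ξ)‖ ≤
      N₀ * (4 * W₀ * (g₀ ^ 2 + s₀ ^ 2 + gs₀) * ∑ p, (fockInner (pderiv p ξ) (pderiv p ξ)).re) := by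
    rw [norm_mul, Complex.norm_real, Real.norm_of_nonneg hN₀]
    exact mul_le_mul_of_nonneg_left hBL2 hN₀
  linarith

end Assembly

end Fock

end Literature.MathematicalPhysics.QuantumManyBody.BoseGas

end
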